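import Mathlib
import HarnessLib
import Literature.MathematicalPhysics.QuantumFieldTheory.UniformTorusClusteringProofs
import Summits.QuantumFields.YangMills.Theorems.PencilRigidityCurvatureKernelBoundStrongCouplingClusteringDiscExplicit

/-!
# `CurvatureKernelBound` — strong-coupling torus clustering on the full cluster-expansion disc
# (crux stmt-QuantumFields-11687, line `coupling-trichotomy`, brick `StrongCouplingClusteringDiscR`)

This is the full-radius form of the tree theorems `StrongCouplingClusteringDisc` /
`StrongCouplingClusteringDiscExplicit` (same namespace): those take the strong-coupling radius
`betaOne d ρ / 2`, although the torus replica bound `PlaqSystem.norm_truncatedExpect_le` holds on every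
closed disc `‖β‖ ≤ r` with `r < betaR = betaOne d ρ`.  Here the hypothesis is relaxed to
`β' < betaOne d ρ` by choosing the intermediate radius `r := (β' + betaOne d ρ) / 2`, so that
`β' < r < betaOne d ρ`; the mass is `m := log (r / β') > 0` and `(‖β‖/r)^n ≤ (β'/r)^n = e^{−m n}` for every
`|β| ≤ β'`.  Everything else is the replica-expansion argument of the original brick verbatim (its public
helper lemmas `abs_truncated_le_norm_expect`, `card_seedsOf_torusSystem_le`, `disjoint_image_torusRed`,
`tdist_le_of_touches`, `le_tdist_of_touches_shift`, `pow_div_le_exp_neg`, … are reused by import).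
[folklore]
-/

noncomputable section

open MeasureTheory Measure ProbabilityTheory Finset Filter
open scoped Topology
open Literature.MathematicalPhysics.QuantumFieldTheory
open Literature.MathematicalPhysics.QuantumLattice (configShift configShift_apply toTorusObservable
  IsCylinder LGConfig)
open Literature.Probability.LatticeModels (Torus.proj Torus.proj_apply)
open Literature.Probability.LatticeModels.Site (supNorm supNorm_le_iff natAbs_le_supNorm
  exists_natAbs_eq_supNorm norm_eq_supNorm)

namespace Summit.QuantumFields.YangMills.Theorems.CurvatureKernel

/-- **Stub `StrongCouplingClusteringDiscR`** (registered signature verbatim). Exponential clustering of the torus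
Wilson states at strong coupling with ONE mass `m = log ((β' + betaOne d ρ) / (2 β'))` and ONE constant
`C(F₁, F₂)` for all couplings `|β| ≤ β' < betaOne d ρ` (the full cluster-expansion radius), all torus sides and
all displacements of less than half the period (full-radius form of `StrongCouplingClusteringDiscExplicit`, same
proof with the intermediate radius `r = (β' + betaOne d ρ) / 2`: replica expansion of the torus plaquette system +
Schwarz lemma). [folklore] -/
theorem StrongCouplingClusteringDiscR : open Literature.MathematicalPhysics.QuantumLattice Literature.MathematicalPhysics.QuantumFieldTheory in ∀ (d N : ℕ) (G : Type) [Group G] [TopologicalSpace G] [IsTopologicalGroup G] [CompactSpace G] [T2Space G] [SecondCountableTopology G] [MeasurableSpace G] [BorelSpace G] (ρ : G →* Matrix (Fin N) (Fin N) ℂ), 2 ≤ d → Continuous ρ → ∀ β' : ℝ, 0 < β' → β' < betaOne d ρ → ∃ m : ℝ, 0 < m ∧ ∀ F₁ F₂ : LGConfig d G → ℝ, Literature.MathematicalPhysics.QuantumLattice.IsLocalObservable F₁ → Literature.MathematicalPhysics.QuantumLattice.IsLocalObservable F₂ → Measurable F₁ → Measurable F₂ → (∃ C, ∀ U, |F₁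 U| ≤ C) → (∃ C, ∀ U, |F₂ U| ≤ C) → ∃ C : ℝ, ∀ β : ℝ, |β| ≤ β' → ∀ (L : ℕ) (x : Literature.Probability.LatticeModels.Site d), 2 * ‖x‖ < (L : ℝ) + 1 → |wilsonExpectation (L := L + 1) ρ β (toTorusObservable (L + 1) fun U => F₁ U * F₂ (configShift x U)) - wilsonExpectation (L := L + 1) ρ β (toTorusObservable (L + 1) F₁) * wilsonExpectation (L := L + 1) ρ β (toTorusObservable (L + 1) (F₂ ∘ configShift x))| ≤ C * Real.exp (-m * ‖x‖) := by
  intro d N G _ _ _ _ _ _ _ _ ρ hd hρ β' hβ'0 hβ'1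
  classical
  haveI : NeZero d := ⟨by omega⟩
  -- the strong-coupling radius: halfway between `β'` and the cluster-expansion radius `betaOne d ρ`
  set r : ℝ := (β' + betaOne d ρ) / 2 with hrdef
  have hr : 0 < r := by rw [hrdef]; linarith
  have hrR : r < betaOne d ρ := by rw [hrdef]; linarith
  have hβ'r : β' < r := by rw [hrdef]; linarith
  -- the mass, uniform on the closed coupling disc `|β| ≤ β'`
  set m : ℝ := Real.log (r / β') with hmdef
  have hm : 0 < m := Real.log_pos ((one_lt_div hβ'0).2 hβ'r)
  refine ⟨m, hm, fun F₁ F₂ hloc₁ hloc₂ h₁m h₂m hb₁ hb₂ => ?_⟩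
  obtain ⟨B₁, hB₁⟩ := hloc₁
  obtain ⟨S₂, hS₂⟩ := hloc₂
  obtain ⟨C₁, hC₁⟩ := hb₁
  obtain ⟨C₂, hC₂⟩ := hb₂
  have hC₁0 : 0 ≤ C₁ := (abs_nonneg _).trans (hC₁ fun _ => 1)
  have hC₂0 : 0 ≤ C₂ := (abs_nonneg _).trans (hC₂ fun _ => 1)
  -- the constants
  set c : ℕ := bondRadius B₁ + bondRadius S₂ + 2 with hcdef
  set sB : ℕ := (B₁.card + S₂.card) * (2 ^ d * (d * d)) with hsB
  set κ : ℝ := 2 * Real.exp (1 / 2) with hκ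
  have hκ1 : 1 ≤ κ := by
    rw [hκ]; have := Real.one_lt_exp_iff.2 (by norm_num : (0 : ℝ) < 1 / 2); linarith
  set Kunif : ℝ := C₁ * C₂ * κ ^ sB + C₁ * κ ^ sB * (C₂ * κ ^ sB) with hKunif
  have hKunif0 : 0 ≤ Kunif := by positivity
  refine ⟨Kunif * Real.exp (m * c), fun β hββ' L x hx => ?_⟩
  -- the torus system of side `L + 1`
  set L' : ℕ := L + 1 with hL'
  have hR : (torusSystem (d := d) (G := G) ρ L').Regular (costBound ρ) (Plaq.degBound d) :=
    torusSystem_regular ρ hρ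
  set X₀ : ℕ := supNorm x with hX₀
  have hxn : ‖x‖ = (X₀ : ℝ) := norm_eq_supNorm x
  have hx' : 2 * X₀ < L' := by
    have h : (2 : ℝ) * X₀ < (L : ℝ) + 1 := by rwa [hxn] at hx
    exact_mod_cast h
  -- the twisted observables
  set Φ₁ : ZdGaugeConfig d G → ℂ := fun U => (F₁ (U ∘ torusRed L') : ℂ) with hΦ₁
  set Φ₂ : ZdGaugeConfig d G → ℂ := fun U => (F₂ (configShift x (U ∘ torusRed L')) : ℂ) with hΦ₂
  set B₂ : Finset (ZdEdge d) := S₂.image fun e => (e.1 - x, e.2) with hB₂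
  have hΦ₁m : Measurable Φ₁ :=
    Complex.measurable_ofReal.comp (h₁m.comp (measurable_comp_relabel (torusRed L')))
  have hΦ₂m : Measurable Φ₂ :=
    Complex.measurable_ofReal.comp ((h₂m.comp (configShift x).measurable).comp
      (measurable_comp_relabel (torusRed L')))
  have hΦ₁b : ∀ U, ‖Φ₁ U‖ ≤ C₁ := fun U => by
    rw [hΦ₁, Complex.norm_real, Real.norm_eq_abs]; exact hC₁ _
  have hΦ₂b : ∀ U, ‖Φ₂ U‖ ≤ C₂ := fun U => by
    rw [hΦ₂, Complex.norm_real, Real.norm_eq_abs]; exact hC₂ _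
  have hΦ₁d : DependsOn Φ₁ ((B₁.image (torusRed L') : Finset (ZdEdge d)) : Set (ZdEdge d)) :=
    dependsOn_comp_torusRed L' (F := fun U => (F₁ U : ℂ)) fun U V h => by
      show (F₁ U : ℂ) = F₁ V; rw [hB₁ h]
  have hΦ₂d : DependsOn Φ₂ ((B₂.image (torusRed L') : Finset (ZdEdge d)) : Set (ZdEdge d)) := by
    have h := IsCylinder.comp_configShift hS₂ x
    exact dependsOn_comp_torusRed L' (F := fun U => ((F₂ ∘ configShift x) U : ℂ)) fun U V h' => by
      show (((F₂ ∘ configShift x) U : ℝ) : ℂ) = ((F₂ ∘ configShift x) V : ℝ); rw [h h']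
  -- step 1: the real truncated correlation is dominated by the complex one
  refine (abs_truncated_le_norm_expect ρ hρ β L' h₁m h₂m hC₁ hC₂ x).trans ?_
  change ‖(torusSystem ρ L').expect (fun U => Φ₁ U * Φ₂ U) (torusGenuine d L') β -
      (torusSystem ρ L').expect Φ₁ (torusGenuine d L') β *
        (torusSystem ρ L').expect Φ₂ (torusGenuine d L') β‖ ≤ Kunif * Real.exp (m * c) *
    Real.exp (-m * ‖x‖)
  -- seed counts, uniformly in `L` and `x`
  have hs₁ : ((torusSystem (G := G) ρ L').seedsOf (B₁.image (torusRed L'))).card ≤ sB := by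
    refine (card_seedsOf_torusSystem_le ρ B₁).trans ((card_seedsOf_le_mul B₁).trans ?_)
    rw [hsB]; exact Nat.mul_le_mul_right _ (Nat.le_add_right _ _)
  have hB₂c : B₂.card ≤ S₂.card := Finset.card_image_le
  have hs₂ : ((torusSystem (G := G) ρ L').seedsOf (B₂.image (torusRed L'))).card ≤ sB := by
    refine (card_seedsOf_torusSystem_le ρ B₂).trans ((card_seedsOf_le_mul B₂).trans ?_)
    rw [hsB]; exact Nat.mul_le_mul_right _ (hB₂c.trans (Nat.le_add_left _ _))
  have hs₁₂ : ((torusSystem (G := G) ρ L').seedsOf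
      (B₁.image (torusRed L') ∪ B₂.image (torusRed L'))).card ≤ sB := by
    rw [← Finset.image_union]
    refine (card_seedsOf_torusSystem_le ρ _).trans ((card_seedsOf_le_mul _).trans ?_)
    rw [hsB]
    exact Nat.mul_le_mul_right _ ((Finset.card_union_le _ _).trans (Nat.add_le_add_left hB₂c _))
  have hK : C₁ * C₂ * κ ^ ((torusSystem (G := G) ρ L').seedsOf
        (B₁.image (torusRed L') ∪ B₂.image (torusRed L'))).card +
      C₁ * κ ^ ((torusSystem (G := G) ρ L').seedsOf (B₁.image (torusRed L'))).card *
        (C₂ * κ ^ ((torusSystem (G := G) ρ L').seedsOf (B₂.image (torusRed L'))).card) ≤ Kunif := by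
    rw [hKunif]
    refine add_le_add (mul_le_mul_of_nonneg_left (pow_le_pow_right₀ hκ1 hs₁₂) (by positivity))
      (mul_le_mul (mul_le_mul_of_nonneg_left (pow_le_pow_right₀ hκ1 hs₁) hC₁0)
        (mul_le_mul_of_nonneg_left (pow_le_pow_right₀ hκ1 hs₂) hC₂0) (by positivity)
        (by positivity))
  -- the coupling in the closed disc `|β| ≤ β' < r` (negative couplings included)
  have hβn' : ‖(β : ℂ)‖ ≤ β' := by rw [Complex.norm_real, Real.norm_eq_abs]; exact hββ'
  have hβn : ‖(β : ℂ)‖ ≤ r := hβn'.trans hβ'r.le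
  have hβR : ‖(β : ℂ)‖ ≤ PlaqSystem.betaR (costBound ρ) (Plaq.degBound d) := by
    rw [betaR_costBound]; exact hβn.trans hrR.le
  have hexp : Real.exp (m * c) * Real.exp (-m * ‖x‖) = Real.exp (m * c - m * X₀) := by
    rw [← Real.exp_add, hxn]; ring_nf
  by_cases hfar : c < X₀
  · -- far displacements: disjoint supports, long joining polymers
    have hdisj : Disjoint (B₁.image (torusRed L')) (B₂.image (torusRed L')) :=
      disjoint_image_torusRed (by rw [hcdef] at hfar; omega) hx'
    have hn : ∀ Q, Q ⊆ torusGenuine d L' →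
        (torusSystem (G := G) ρ L').Joins Q (B₁.image (torusRed L')) (B₂.image (torusRed L')) →
        X₀ - c ≤ Q.card := by
      intro Q _ hJ
      have h := PlaqSystem.le_card_of_joins (S := torusSystem (G := G) ρ L')
        (fun p => tdist L' originPlaq p)
        (fun u v huv => tdist_le_of_tadj originPlaq ((torusSystem_adj_iff ρ).1 huv))
        (a := bondRadius B₁ + 1) (b := X₀ - bondRadius S₂ - 1)
        (fun p hp => by
          obtain ⟨y, rfl, hy⟩ := (touches_torusSystem_iff ρ B₁ p).1 hp
          exact tdist_le_of_touches hy)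
        (fun q hq => by
          obtain ⟨y, rfl, hy⟩ := (touches_torusSystem_iff ρ B₂ q).1 hq
          exact le_tdist_of_touches_shift hy hx') hJ
      rw [hcdef]; omega
    have hbound := PlaqSystem.norm_truncatedExpect_le hR hΦ₁m hΦ₂m hΦ₁b hΦ₂b hΦ₁d hΦ₂d hdisj
      (torusGenuine d L') hn hr (by rwa [betaR_costBound]) hβn
    refine hbound.trans ?_
    -- the decay factor, uniformly on the disc: `(‖β‖/r)^n ≤ (β'/r)^n = e^{-m n}`
    have hdec : (‖(β : ℂ)‖ / r) ^ (X₀ - c) ≤ Real.exp (-(m * ((X₀ - c : ℕ) : ℝ))) := by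
      have h1 : (‖(β : ℂ)‖ / r) ^ (X₀ - c) ≤ (β' / r) ^ (X₀ - c) :=
        pow_le_pow_left₀ (by positivity) (div_le_div_of_nonneg_right hβn' hr.le) _
      have h2 := pow_div_le_exp_neg hβ'0.le hr (X₀ - c)
      rw [if_neg hβ'0.ne', ← hmdef] at h2
      exact h1.trans h2
    calc _ ≤ Kunif * Real.exp (-(m * ((X₀ - c : ℕ) : ℝ))) :=
          mul_le_mul hK hdec (by positivity) hKunif0
      _ = Kunif * Real.exp (m * c) * Real.exp (-m * ‖x‖) := by
          rw [mul_assoc, hexp, Nat.cast_sub hfar.le]; ring_nf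
  · -- near displacements: the crude bound
    push Not at hfar
    have hbound := PlaqSystem.norm_truncatedExpect_le_const hR hβR hΦ₁m hΦ₂m hΦ₁b hΦ₂b hΦ₁d hΦ₂d
      (torusGenuine d L')
    refine (hbound.trans hK).trans ?_
    rw [mul_assoc, hexp]
    have h1 : (1 : ℝ) ≤ Real.exp (m * c - m * X₀) := by
      refine Real.one_le_exp ?_
      have : (X₀ : ℝ) ≤ c := by exact_mod_cast hfar
      nlinarith
    nlinarith

end Summit.QuantumFields.YangMills.Theorems.CurvatureKernel

end
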